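import Summits.KontsevichZagierPeriods.KontsevichZagierPeriods.Theorems.SoloBlindPiTorsionSplit
import HarnessLib

/-!
# The lattice of splits of the summit statement

`SoloBlind.kz_iff_injective_evalQ` identifies `Literature.Periods.KZPeriodConjecture` with the
injectivity of the period map `evalQ : Q →+* ℝ` on the formal period ring `Q`.  For a class
`p : Q` write

* `Tors p` for "KZ up to `p`-power torsion": every class of period `0` is killed by a power of `p`
  (`∀ x, evalQ x = 0 → ∃ n, p ^ n * x = 0`);
* `(C)_p` for "`p` cancels": `p ∈ nonZeroDivisors Q`.

This file records, without any localisation machinery, how these statements move with `p` and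
that the summit statement is recovered from a MIXED pair: for `p ∣ p'` with `evalQ p' ≠ 0`,

  `KZPeriodConjecture ↔ Tors p ∧ (C)_{p'}`      (`SoloBlind.kz_iff_torsion_and_cancel_of_dvd`).

`Tors` is monotone along divisibility (`SoloBlind.torsion_of_dvd`), `(C)` is antitone
(`SoloBlind.cancel_of_dvd`), classes of non-zero algebraic constants always cancel
(`SoloBlind.algebraMap_mem_nonZeroDivisors`), and for a unit `p` the torsion statement alone is
already the summit statement (`SoloBlind.kz_iff_torsion_of_isUnit`).  So the family of splits
"`KZ ↔ Tors p ∧ (C)_p`" is an interval family: the torsion half may be taken at the smallest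
and the cancellation half at the largest element of any divisibility chain of classes of
non-zero period.
-/

namespace Summit.KontsevichZagierPeriods.KontsevichZagierPeriods.Theorems

open Literature.NumberTheory.Transcendental
open Literature.NumberTheory.Transcendental.KZ

namespace SoloBlind

/-! ## Monotonicity -/

/-- `Tors` is monotone along divisibility: if every period-zero class is `p`-power torsion and
`p ∣ p'`, then every period-zero class is `p'`-power torsion. -/
theorem torsion_of_dvd {p p' : Q} (hpp' : p ∣ p')
    (h : ∀ x : Q, evalQ x = 0 → ∃ n : ℕ, p ^ n * x = 0) :
    ∀ x : Q, evalQ x = 0 → ∃ n : ℕ, p' ^ n * x = 0 := by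
  intro x hx
  obtain ⟨c, rfl⟩ := hpp'
  obtain ⟨n, hn⟩ := h x hx
  exact ⟨n, by linear_combination c ^ n * hn⟩

/-- `(C)` is antitone along divisibility: a divisor of a cancelling class cancels. -/
theorem cancel_of_dvd {p p' : Q} (hpp' : p ∣ p') (h : p' ∈ nonZeroDivisors Q) :
    p ∈ nonZeroDivisors Q := by
  obtain ⟨c, rfl⟩ := hpp'
  exact (mul_mem_nonZeroDivisors.mp h).1

/-- A cancelling class kills no non-zero class by any of its powers. -/
theorem eq_zero_of_pow_mul_eq_zero {p : Q} (h : p ∈ nonZeroDivisors Q) {x : Q} {n : ℕ}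
    (hx : p ^ n * x = 0) : x = 0 :=
  (mul_left_mem_nonZeroDivisors_eq_zero_iff (pow_mem h n)).mp hx

/-- Classes of non-zero algebraic constants cancel: `(C)_p` holds for `p = algebraMap K₀ Q β`,
`β ≠ 0` (the case of a `0`-dimensional representation). -/
theorem algebraMap_mem_nonZeroDivisors {β : K₀} (hβ : β ≠ 0) :
    algebraMap K₀ Q β ∈ nonZeroDivisors Q :=
  ((IsUnit.mk0 β hβ).map (algebraMap K₀ Q)).mem_nonZeroDivisors

/-! ## The summit statement from a mixed pair -/

/-- **`Tors p ∧ (C)_{p'} ⟹ KZPeriodConjecture` whenever `p ∣ p'`** (no hypothesis on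
periods). -/
theorem kz_of_torsion_of_cancel {p p' : Q} (hpp' : p ∣ p')
    (hT : ∀ x : Q, evalQ x = 0 → ∃ n : ℕ, p ^ n * x = 0) (hC : p' ∈ nonZeroDivisors Q) :
    Literature.Periods.KZPeriodConjecture := by
  rw [kz_iff_injective_evalQ, injective_iff_map_eq_zero]
  intro x hx
  obtain ⟨n, hn⟩ := hT x hx
  exact eq_zero_of_pow_mul_eq_zero (cancel_of_dvd hpp' hC) hn

/-- The summit statement gives `Tors p` for every `p` (with exponent `0`). -/
theorem torsion_of_kz (h : Literature.Periods.KZPeriodConjecture) (p : Q) :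
    ∀ x : Q, evalQ x = 0 → ∃ n : ℕ, p ^ n * x = 0 := by
  intro x hx
  refine ⟨0, ?_⟩
  rw [pow_zero, one_mul]
  exact (injective_iff_map_eq_zero evalQ).mp (kz_iff_injective_evalQ.mp h) x hx

/-- **The interval split: for `p ∣ p'` with `evalQ p' ≠ 0`,
`KZPeriodConjecture ↔ Tors p ∧ (C)_{p'}`.** -/
theorem kz_iff_torsion_and_cancel_of_dvd {p p' : Q} (hpp' : p ∣ p') (hp' : evalQ p' ≠ 0) :
    Literature.Periods.KZPeriodConjecture ↔
      (∀ x : Q, evalQ x = 0 → ∃ n : ℕ, p ^ n * x = 0) ∧ p' ∈ nonZeroDivisors Q :=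
  ⟨fun h => ⟨torsion_of_kz h p, mem_nonZeroDivisors_of_kz h hp'⟩,
    fun h => kz_of_torsion_of_cancel hpp' h.1 h.2⟩

/-- The diagonal case `p = p'`: `KZPeriodConjecture ↔ Tors p ∧ (C)_p` for any class of non-zero
period (the localisation-free form of the split). -/
theorem kz_iff_torsion_and_cancel_self {p : Q} (hp : evalQ p ≠ 0) :
    Literature.Periods.KZPeriodConjecture ↔
      (∀ x : Q, evalQ x = 0 → ∃ n : ℕ, p ^ n * x = 0) ∧ p ∈ nonZeroDivisors Q :=
  kz_iff_torsion_and_cancel_of_dvd (dvd_refl p) hp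

/-- For a unit `p` the torsion statement alone is the summit statement. -/
theorem kz_iff_torsion_of_isUnit {p : Q} (hp : IsUnit p) :
    Literature.Periods.KZPeriodConjecture ↔
      ∀ x : Q, evalQ x = 0 → ∃ n : ℕ, p ^ n * x = 0 :=
  ⟨fun h => torsion_of_kz h p,
    fun h => kz_of_torsion_of_cancel (dvd_refl p) h hp.mem_nonZeroDivisors⟩

/-- In particular, with `p` the class of a non-zero algebraic constant `β`:
`KZPeriodConjecture ↔` every period-zero class is killed by a power of `β` — i.e. is `0`,
recovering `SoloBlind.kz_iff_injective_evalQ` as the bottom of the lattice. -/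
theorem kz_iff_torsion_algebraMap {β : K₀} (hβ : β ≠ 0) :
    Literature.Periods.KZPeriodConjecture ↔
      ∀ x : Q, evalQ x = 0 → ∃ n : ℕ, algebraMap K₀ Q β ^ n * x = 0 :=
  kz_iff_torsion_of_isUnit ((IsUnit.mk0 β hβ).map (algebraMap K₀ Q))

end SoloBlind

end Summit.KontsevichZagierPeriods.KontsevichZagierPeriods.Theorems
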